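import Summits.Ventures.CertifiedArithmetic.LowPrec.AccumulateLangeRump
import Summits.Ventures.CertifiedArithmetic.LowPrec.GemmBeyondHalfUlp
import Summits.Ventures.CertifiedArithmetic.LowPrec.OptTreePolySigned

/-!
# The Lange–Rump restriction has ZERO tolerance under binary ties-to-even (every format, p ≥ 5)

HONEST FRAMING (venture CertifiedArithmetic / cell `pub-lowprec`): certified error envelopes and
provably optimal rounding/accumulation schemes for low-precision formats under stated cost models;
every table by two implementations; no hardware or vendor claims.

`AccumulateLangeRump` (Lange–Rump Prop. 1 = BJMM Thm 4.5, every format): `n ≤ ½u⁻¹` additions of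
values of `α` give `|ŝ - s| ≤ n u/(1 + n u)·Σ|xᵢ|`.  [LangeRump2018, Remark 2]: the restriction
cannot be moved to `½u⁻¹ + 2` ("tolerance not greater than β/2"; bfloat16 kernel
`langeRump_fails_at_130_BFloat16`).  The cell's GEMM note, Prop. `p:sharp` (gemm seat; paper proof
for every `p ≥ 5`, kernel for bfloat16 as `TieChain.lr130_*`), closes the gap for BINARY ties-to-
even: the bound fails at the FIRST excluded length.  THIS FILE PROVES IT FOR EVERY FORMAT with
`m ≥ 4` whose range holds the data (`8H² + 8H ≤ maxScaled`, `H = 2^(m-1) = ¼u⁻¹`).  With `q` one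
quantum, the input `lrZeroData H q = (4H², 3H^{×H}, 2H+1, 2H, (-2H)^{×(H-1)})·q` (`n = 2H + 1`
additions) climbs by ties — `ŝⱼ = (4H²+4jH)q`, each `ŝⱼ + 3Hq` being the midpoint above the ODD
significand `2H+2j+1` (`toRat_roundNE_gmid_odd`) — to `8H²q`, then `+(2H+1)q ↦ (8H²+4H)q` (one
quantum above a midpoint), `+2Hq ↦ (8H²+8H)q` (tie above the odd `2H+1`), and every `-2Hq` returns
to that tie: `ŝₙ = (8H²+8H)q`, `s = (5H²+6H+1)q`, `Σ|xᵢ| = (9H²+2H+1)q`, `n u = (2H+1)/(4H)`, and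
`(3H²+2H-1)(6H+1) - (2H+1)(9H²+2H+1) = 2H² - 8H - 2 > 0 ⇔ H ≥ 8 ⇔ m ≥ 4`.
* `LangeRumpZeroTolerance α` (the statement), `langeRump_tolerance_zero` (`m ≥ 4` + range ⟹ it),
  `langeRump_restriction_sharp` (`2 n u ≤ 1` cannot become `2 n u ≤ 1 + 2u`), instances
  `_BFloat16` (`n = 129`, the case `langeRump_fails_at_130_BFloat16` left open; gemm's data
  `(2¹⁸, 3072^{×64}, 2064, 2048, -2048^{×63})` are these scaled by `2¹²`), `_Binary16`, `_Binary32`.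
At `p = 4` the mechanism does not bite (`H = 4`), in line with gemm's replay (`55/153 < 9/25`) and
implementation A's window scan (`p = 4`, `n = 10`: no tree/input exceeds `9/25`; not a theorem).
-/

namespace Literature.ComputerArithmetic.FloatingPoint

namespace MiniFloat

open Finset Format
open Summit.Ventures.CertifiedArithmetic

variable {α : Format}

/-! ## §1 The data -/

/-- The zero-tolerance input `(4H², 3H ×H, 2H+1, 2H, -2H, -2H, …)` scaled by `s`
(gemm.tex Prop. p:sharp with `U = 2H·s`, `M = H/2`). [folklore] -/
def lrZeroData (H : ℕ) (s : ℚ) (i : ℕ) : ℚ :=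
  if i = 0 then 4 * (H : ℚ) ^ 2 * s
  else if i ≤ H then 3 * (H : ℚ) * s
  else if i = H + 1 then (2 * (H : ℚ) + 1) * s
  else if i = H + 2 then 2 * (H : ℚ) * s
  else -(2 * (H : ℚ) * s)

/-- Head letter. -/
theorem lrZeroData_zero (H : ℕ) (s : ℚ) : lrZeroData H s 0 = 4 * (H : ℚ) ^ 2 * s := by
  simp [lrZeroData]

/-- Climb letters `1 ≤ i ≤ H`. -/
theorem lrZeroData_climb {H : ℕ} (s : ℚ) {i : ℕ} (h0 : 1 ≤ i) (hH : i ≤ H) :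
    lrZeroData H s i = 3 * (H : ℚ) * s := by
  simp [lrZeroData, show i ≠ 0 by omega, hH]

/-- Letter `H + 1`. -/
theorem lrZeroData_switch (H : ℕ) (s : ℚ) : lrZeroData H s (H + 1) = (2 * (H : ℚ) + 1) * s := by
  simp [lrZeroData]

/-- Letter `H + 2`. -/
theorem lrZeroData_top (H : ℕ) (s : ℚ) : lrZeroData H s (H + 2) = 2 * (H : ℚ) * s := by
  simp [lrZeroData]

/-- Tail letters `i ≥ H + 3`. -/
theorem lrZeroData_tail {H : ℕ} (s : ℚ) {i : ℕ} (h : H + 2 < i) :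
    lrZeroData H s i = -(2 * (H : ℚ) * s) := by
  simp [lrZeroData, show i ≠ 0 by omega, show ¬ i ≤ H by omega, show i ≠ H + 1 by omega,
    show i ≠ H + 2 by omega]

/-- Prefix sums: `Σ_{i ≤ H+2} xᵢ = (7H² + 4H + 1)·s` and `Σ_{i ≤ H+2} |xᵢ| = (7H² + 4H + 1)·s`
(`s ≥ 0`: the prefix is nonnegative). -/
theorem sum_lrZeroData_prefix (H : ℕ) {s : ℚ} (hs : 0 ≤ s) :
    ∑ i ∈ range (H + 2 + 1), lrZeroData H s i = (7 * (H : ℚ) ^ 2 + 4 * H + 1) * s ∧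
    ∑ i ∈ range (H + 2 + 1), |lrZeroData H s i| = (7 * (H : ℚ) ^ 2 + 4 * H + 1) * s := by
  have hclimb : ∑ i ∈ range (H + 1), lrZeroData H s i
      = 4 * (H : ℚ) ^ 2 * s + H * (3 * (H : ℚ) * s) := by
    rw [Finset.sum_range_succ', lrZeroData_zero, add_comm]
    congr 1
    rw [Finset.sum_congr rfl fun i hi => lrZeroData_climb s (by omega)
      (by have := Finset.mem_range.mp hi; omega), Finset.sum_const, Finset.card_range]
    simp
  have hnonneg : ∀ i ∈ range (H + 2 + 1), 0 ≤ lrZeroData H s i := by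
    intro i hi
    have hi' := Finset.mem_range.mp hi
    unfold lrZeroData
    split_ifs <;> first | positivity | (exfalso; omega)
  have h1 : ∑ i ∈ range (H + 2 + 1), lrZeroData H s i = (7 * (H : ℚ) ^ 2 + 4 * H + 1) * s := by
    rw [Finset.sum_range_succ, Finset.sum_range_succ, hclimb, lrZeroData_switch, lrZeroData_top]
    ring
  refine ⟨h1, ?_⟩
  rw [Finset.sum_congr rfl fun i hi => abs_of_nonneg (hnonneg i hi), h1]

/-! ## §2 The trajectory in a format (`H = 2^(m-1)`, `s` = one quantum) -/

/-- `2^m = 2H` for `m ≥ 1`. -/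
theorem two_pow_manBits_eq_two_mul (hm : 1 ≤ α.manBits) :
    2 ^ α.manBits = 2 * 2 ^ (α.manBits - 1) := by
  rw [← pow_succ']; congr 1; omega

section Trajectory

variable (hm : 1 ≤ α.manBits)
  (hR : 8 * (2 ^ (α.manBits - 1)) ^ 2 + 8 * 2 ^ (α.manBits - 1) ≤ α.maxScaled)
include hm hR

/-- CLIMB STEP: `fl((4H² + 4jH)q + 3Hq) = (4H² + 4(j+1)H)q` for `j < H` (tie above the odd
significand `2H + 2j + 1`). -/
theorem lrZero_climb_step {j : ℕ} (hj : j < 2 ^ (α.manBits - 1)) :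
    (roundNE α ((4 * ((2 ^ (α.manBits - 1) : ℕ) : ℚ) ^ 2 + 4 * j * ((2 ^ (α.manBits - 1) : ℕ) : ℚ))
        * α.quantum + 3 * ((2 ^ (α.manBits - 1) : ℕ) : ℚ) * α.quantum)).toRat
      = (4 * ((2 ^ (α.manBits - 1) : ℕ) : ℚ) ^ 2 + 4 * (j + 1) * ((2 ^ (α.manBits - 1) : ℕ) : ℚ))
        * α.quantum := by
  have h2 := two_pow_manBits_eq_two_mul hm
  set H : ℕ := 2 ^ (α.manBits - 1) with hH
  have hk : 2 ^ (α.manBits - 1 + 1) = 2 * H := by rw [pow_succ, hH]; ring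
  have hmid : (2 * (2 * H + 2 * j + 1) + 1) * 2 ^ (α.manBits - 1)
      = 4 * H ^ 2 + 4 * j * H + 3 * H := by
    rw [← hH]; ring
  have hup : (2 * H + 2 * j + 1 + 1) * 2 ^ (α.manBits - 1 + 1) = 4 * H ^ 2 + 4 * (j + 1) * H := by
    rw [hk]; ring
  have harg : (4 * (H : ℚ) ^ 2 + 4 * j * (H : ℚ)) * α.quantum + 3 * (H : ℚ) * α.quantum
      = (((2 * (2 * H + 2 * j + 1) + 1) * 2 ^ (α.manBits - 1) : ℕ) : ℚ) * α.quantum := by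
    rw [hmid]; push_cast; ring
  rw [harg, toRat_roundNE_gmid_odd hm ⟨H + j, by ring⟩ (by rw [h2]; omega)
    (by rw [pow_succ, h2]; omega)
    (by rw [hup]; exact le_trans (by nlinarith) hR), hup]
  push_cast; ring

/-- SWITCH STEP: `fl(8H²q + (2H+1)q) = (8H² + 4H)q` (one quantum above the midpoint `8H² + 2H`). -/
theorem lrZero_switch_step :
    (roundNE α (8 * ((2 ^ (α.manBits - 1) : ℕ) : ℚ) ^ 2 * α.quantum
        + (2 * ((2 ^ (α.manBits - 1) : ℕ) : ℚ) + 1) * α.quantum)).toRat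
      = (8 * ((2 ^ (α.manBits - 1) : ℕ) : ℚ) ^ 2 + 4 * ((2 ^ (α.manBits - 1) : ℕ) : ℚ))
        * α.quantum := by
  have h2 := two_pow_manBits_eq_two_mul hm
  set H : ℕ := 2 ^ (α.manBits - 1) with hH
  have hq := α.quantum_pos
  have hH1 : 1 ≤ H := Nat.one_le_two_pow
  have hmid : (2 * (2 * H) + 1) * 2 ^ α.manBits = 8 * H ^ 2 + 2 * H := by rw [h2]; ring
  have hup : (2 * H + 1) * 2 ^ (α.manBits + 1) = 8 * H ^ 2 + 4 * H := by rw [pow_succ, h2]; ring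
  have harg : 8 * (H : ℚ) ^ 2 * α.quantum + (2 * (H : ℚ) + 1) * α.quantum
      = (((2 * (2 * H) + 1) * 2 ^ α.manBits : ℕ) : ℚ) * α.quantum + α.quantum := by
    rw [hmid]; push_cast; ring
  rw [harg, toRat_roundNE_above_gmid (by rw [h2]) (by rw [pow_succ, h2]; omega)
    (by rw [hup]; exact le_trans (by nlinarith) hR) hq ?_, hup]
  · push_cast; ring
  · have : (1 : ℚ) < 2 ^ α.manBits := one_lt_pow₀ (by norm_num) (by omega)
    nlinarith

/-- TOP TIE: `fl((8H² + 6H)q) = (8H² + 8H)q` (tie above the odd significand `2H + 1`); this is both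
the step `+ 2Hq` from `(8H²+4H)q` and every tail step `- 2Hq` from `(8H²+8H)q`. -/
theorem lrZero_top_tie :
    (roundNE α ((8 * ((2 ^ (α.manBits - 1) : ℕ) : ℚ) ^ 2 + 6 * ((2 ^ (α.manBits - 1) : ℕ) : ℚ))
        * α.quantum)).toRat
      = (8 * ((2 ^ (α.manBits - 1) : ℕ) : ℚ) ^ 2 + 8 * ((2 ^ (α.manBits - 1) : ℕ) : ℚ))
        * α.quantum := by
  have h2 := two_pow_manBits_eq_two_mul hm
  set H : ℕ := 2 ^ (α.manBits - 1) with hH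
  have hH1 : 1 ≤ H := Nat.one_le_two_pow
  have hmid : (2 * (2 * H + 1) + 1) * 2 ^ α.manBits = 8 * H ^ 2 + 6 * H := by rw [h2]; ring
  have hup : (2 * H + 1 + 1) * 2 ^ (α.manBits + 1) = 8 * H ^ 2 + 8 * H := by rw [pow_succ, h2]; ring
  have harg : (8 * (H : ℚ) ^ 2 + 6 * (H : ℚ)) * α.quantum
      = (((2 * (2 * H + 1) + 1) * 2 ^ α.manBits : ℕ) : ℚ) * α.quantum := by
    rw [hmid]; push_cast; ring
  rw [harg, toRat_roundNE_gmid_odd hm ⟨H, rfl⟩ (by rw [h2]; omega) (by rw [pow_succ, h2]; omega)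
    (by rw [hup]; exact hR), hup]
  push_cast; ring

/-- THE WHOLE TRAJECTORY: with `x = lrZeroData H q`, `ŝⱼ = (4H²+4jH)q` for `j ≤ H`,
`ŝ_{H+1} = (8H²+4H)q`, and `ŝₖ = (8H²+8H)q` for every `k ≥ H + 2`. -/
theorem seqSum_lrZero :
    (∀ j ≤ 2 ^ (α.manBits - 1), (seqSum α (lrZeroData (2 ^ (α.manBits - 1)) α.quantum) j).toRat
        = (4 * ((2 ^ (α.manBits - 1) : ℕ) : ℚ) ^ 2 + 4 * j * ((2 ^ (α.manBits - 1) : ℕ) : ℚ))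
          * α.quantum) ∧
    (seqSum α (lrZeroData (2 ^ (α.manBits - 1)) α.quantum) (2 ^ (α.manBits - 1) + 1)).toRat
        = (8 * ((2 ^ (α.manBits - 1) : ℕ) : ℚ) ^ 2 + 4 * ((2 ^ (α.manBits - 1) : ℕ) : ℚ))
          * α.quantum ∧
    (∀ k, 2 ^ (α.manBits - 1) + 2 ≤ k →
      (seqSum α (lrZeroData (2 ^ (α.manBits - 1)) α.quantum) k).toRat
        = (8 * ((2 ^ (α.manBits - 1) : ℕ) : ℚ) ^ 2 + 8 * ((2 ^ (α.manBits - 1) : ℕ) : ℚ))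
          * α.quantum) := by
  set H : ℕ := 2 ^ (α.manBits - 1) with hH
  set x := lrZeroData H α.quantum with hx
  have hH1 : 1 ≤ H := Nat.one_le_two_pow
  -- ŝ₀ = x₀ (a power of two within range)
  have h4sq : 4 * H ^ 2 = 2 ^ ((α.manBits - 1) * 2 + 2) := by rw [hH, pow_add, pow_mul]; ring
  have hrep0 : α.Representable (4 * H ^ 2) := by
    rw [h4sq]
    exact Summit.Ventures.CertifiedArithmetic.LowPrec.Opt.representable_two_pow _
      (by rw [← h4sq]; exact le_trans (by nlinarith) hR)
  have h0 : (seqSum α x 0).toRat = (4 * (H : ℚ) ^ 2 + 4 * (0 : ℕ) * (H : ℚ)) * α.quantum := by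
    show (roundNE α (x 0)).toRat = _
    have hx0 : x 0 = ((4 * H ^ 2 : ℕ) : ℚ) * α.quantum := by
      rw [hx, lrZeroData_zero]; push_cast; ring
    rw [hx0, toRat_roundNE_of_exists (exists_toRat_eq_natMul hrep0)]
    push_cast; ring
  -- the climb (orbit template)
  have hclimb : ∀ j ≤ H, (seqSum α x (0 + j)).toRat
      = (4 * (H : ℚ) ^ 2 + 4 * ((j : ℕ) : ℚ) * (H : ℚ)) * α.quantum := by
    refine TieChain.seqSum_orbit x 0 H (3 * (H : ℚ) * α.quantum)
      (fun j => (4 * (H : ℚ) ^ 2 + 4 * ((j : ℕ) : ℚ) * (H : ℚ)) * α.quantum) ?_ h0 ?_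
    · intro j hj; exact lrZeroData_climb α.quantum (by omega) (by omega)
    · intro j hj
      have := lrZero_climb_step hm hR hj
      rw [← hH] at this
      rw [this]; push_cast; ring
  have hH' : (seqSum α x H).toRat = 8 * (H : ℚ) ^ 2 * α.quantum := by
    have := hclimb H le_rfl
    rw [Nat.zero_add] at this
    rw [this]; ring
  -- the switch and the top tie
  have hs1 : (seqSum α x (H + 1)).toRat = (8 * (H : ℚ) ^ 2 + 4 * (H : ℚ)) * α.quantum := by
    show (roundNE α ((seqSum α x H).toRat + x (H + 1))).toRat = _
    rw [hH', hx, lrZeroData_switch]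
    exact lrZero_switch_step hm hR
  have hs2 : (seqSum α x (H + 2)).toRat = (8 * (H : ℚ) ^ 2 + 8 * (H : ℚ)) * α.quantum := by
    show (roundNE α ((seqSum α x (H + 1)).toRat + x (H + 1 + 1))).toRat = _
    rw [hs1, hx, lrZeroData_top, show (8 * (H : ℚ) ^ 2 + 4 * (H : ℚ)) * α.quantum
      + 2 * (H : ℚ) * α.quantum = (8 * (H : ℚ) ^ 2 + 6 * (H : ℚ)) * α.quantum by ring]
    exact lrZero_top_tie hm hR
  -- the stationary tail
  have htail := seqSum_stationary x (H + 2) (-(2 * (H : ℚ) * α.quantum))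
    ((8 * (H : ℚ) ^ 2 + 8 * (H : ℚ)) * α.quantum) (fun k hk => lrZeroData_tail α.quantum hk) hs2
    (by rw [show (8 * (H : ℚ) ^ 2 + 8 * (H : ℚ)) * α.quantum + -(2 * (H : ℚ) * α.quantum)
          = (8 * (H : ℚ) ^ 2 + 6 * (H : ℚ)) * α.quantum by ring]
        exact lrZero_top_tie hm hR)
  refine ⟨fun j hj => ?_, hs1, htail⟩
  have := hclimb j hj
  rw [Nat.zero_add] at this
  exact this


/-- THE DATA ARE VALUES OF `α` (`m ≥ 1`, `4H² ≤ maxScaled`). -/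
theorem lrZero_mem (i : ℕ) :
    ∃ y : MiniFloat α, y.toRat = lrZeroData (2 ^ (α.manBits - 1)) α.quantum i := by
  have h2 := two_pow_manBits_eq_two_mul hm
  set H : ℕ := 2 ^ (α.manBits - 1) with hH
  have hH1 : 1 ≤ H := Nat.one_le_two_pow
  have hmax : 4 * H ≤ α.maxScaled := le_trans (by nlinarith) hR
  have natval : ∀ {n : ℕ}, α.Representable n → ∀ r : ℚ, r = ((n : ℕ) : ℚ) * α.quantum →
      (∃ y : MiniFloat α, y.toRat = r) ∧ (∃ y : MiniFloat α, y.toRat = -r) := by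
    intro n hn r hr
    obtain ⟨y, hy⟩ := exists_toRat_eq_natMul hn
    exact ⟨⟨y, by rw [hy, hr]⟩, ⟨y.flipSign, by rw [toRat_flipSign, hy, hr]⟩⟩
  have small : ∀ n : ℕ, n < 4 * H → α.Representable n := fun n hn =>
    representable_of_lt_pow (by rw [pow_succ, h2]; omega) (by omega)
  unfold lrZeroData
  split_ifs with h0 h1 h2' h3
  · have h4sq : 4 * H ^ 2 = 2 ^ ((α.manBits - 1) * 2 + 2) := by rw [hH, pow_add, pow_mul]; ring
    have hrep0 : α.Representable (4 * H ^ 2) := by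
      rw [h4sq]
      exact Summit.Ventures.CertifiedArithmetic.LowPrec.Opt.representable_two_pow _
        (by rw [← h4sq]; exact le_trans (by nlinarith) hR)
    exact (natval hrep0 _ (by push_cast; ring)).1
  · exact (natval (small (3 * H) (by omega)) _ (by push_cast; ring)).1
  · exact (natval (small (2 * H + 1) (by omega)) _ (by push_cast; ring)).1
  · exact (natval (small (2 * H) (by omega)) _ (by push_cast; ring)).1
  · exact (natval (small (2 * H) (by omega)) _ (by push_cast; ring)).2

/-- EVERY STEP IS IN RANGE (for every length). -/
theorem lrZero_inRange (k : ℕ) : InRange α (lrZeroData (2 ^ (α.manBits - 1)) α.quantum) k := by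
  set H : ℕ := 2 ^ (α.manBits - 1) with hH
  set x := lrZeroData H α.quantum with hx
  have hq := α.quantum_pos
  have hH1 : (1 : ℚ) ≤ (H : ℚ) := by exact_mod_cast (Nat.one_le_two_pow : 1 ≤ H)
  have hmaxRat : (8 * (H : ℚ) ^ 2 + 8 * (H : ℚ)) * α.quantum ≤ α.maxRat := by
    rw [Format.maxRat]
    exact mul_le_mul_of_nonneg_right (by exact_mod_cast hR) hq.le
  have bound : ∀ r : ℚ, 0 ≤ r → r ≤ 8 * (H : ℚ) ^ 2 + 8 * (H : ℚ) → |r * α.quantum| ≤ α.maxRat :=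
    fun r hr0 hr => by
      rw [abs_of_nonneg (by positivity)]; exact le_trans (by nlinarith) hmaxRat
  obtain ⟨hclimb, hs1, htail⟩ := seqSum_lrZero hm hR
  -- the prefix of length H + 2 is in range
  have hpre : InRange α x (H + 2) := by
    refine ⟨?_, fun k hk => ?_⟩
    · rw [hx, lrZeroData_zero,
        show 4 * (H : ℚ) ^ 2 * α.quantum = (4 * (H : ℚ) ^ 2) * α.quantum by ring]
      exact bound _ (by positivity) (by nlinarith)
    rcases Nat.lt_or_ge k H with hkH | hkH
    · -- climb step k → k + 1
      rw [hclimb k hkH.le, hx, lrZeroData_climb α.quantum (by omega) (by omega),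
        show (4 * (H : ℚ) ^ 2 + 4 * (k : ℚ) * H) * α.quantum + 3 * (H : ℚ) * α.quantum
          = (4 * (H : ℚ) ^ 2 + 4 * (k : ℚ) * H + 3 * H) * α.quantum by ring]
      have hk' : (k : ℚ) + 1 ≤ H := by exact_mod_cast hkH
      exact bound _ (by positivity) (by nlinarith)
    · rcases Nat.lt_or_ge k (H + 1) with hk1 | hk1
      · obtain rfl : k = H := by omega
        rw [hclimb H le_rfl, hx, lrZeroData_switch,
          show (4 * (H : ℚ) ^ 2 + 4 * ((H : ℕ) : ℚ) * H) * α.quantum + (2 * (H : ℚ) + 1) * α.quantum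
            = (8 * (H : ℚ) ^ 2 + 2 * H + 1) * α.quantum by ring]
        exact bound _ (by positivity) (by nlinarith)
      · obtain rfl : k = H + 1 := by omega
        rw [hs1, hx, lrZeroData_top,
          show (8 * (H : ℚ) ^ 2 + 4 * (H : ℚ)) * α.quantum + 2 * (H : ℚ) * α.quantum
            = (8 * (H : ℚ) ^ 2 + 6 * H) * α.quantum by ring]
        exact bound _ (by positivity) (by nlinarith)
  refine tieChain_inRange x (H + 2) (-(2 * (H : ℚ) * α.quantum))
    ((8 * (H : ℚ) ^ 2 + 8 * (H : ℚ)) * α.quantum) (fun k hk => lrZeroData_tail α.quantum hk)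
    (htail (H + 2) le_rfl) ?_ hpre ?_ k
  · rw [show (8 * (H : ℚ) ^ 2 + 8 * (H : ℚ)) * α.quantum + -(2 * (H : ℚ) * α.quantum)
        = (8 * (H : ℚ) ^ 2 + 6 * (H : ℚ)) * α.quantum by ring]
    exact lrZero_top_tie hm hR
  · rw [show (8 * (H : ℚ) ^ 2 + 8 * (H : ℚ)) * α.quantum + -(2 * (H : ℚ) * α.quantum)
        = (8 * (H : ℚ) ^ 2 + 6 * (H : ℚ)) * α.quantum by ring]
    exact bound _ (by positivity) (by nlinarith)

/-- THE SUMS at the first excluded length `n = 2H + 1`: `Σ xᵢ = (5H²+6H+1)q`,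
`Σ |xᵢ| = (9H²+2H+1)q`, `ŝₙ = (8H²+8H)q`. -/
theorem lrZero_sums :
    ∑ i ∈ range (2 * 2 ^ (α.manBits - 1) + 1 + 1), lrZeroData (2 ^ (α.manBits - 1)) α.quantum i
        = (5 * ((2 ^ (α.manBits - 1) : ℕ) : ℚ) ^ 2 + 6 * ((2 ^ (α.manBits - 1) : ℕ) : ℚ) + 1)
          * α.quantum ∧
    ∑ i ∈ range (2 * 2 ^ (α.manBits - 1) + 1 + 1), |lrZeroData (2 ^ (α.manBits - 1)) α.quantum i|
        = (9 * ((2 ^ (α.manBits - 1) : ℕ) : ℚ) ^ 2 + 2 * ((2 ^ (α.manBits - 1) : ℕ) : ℚ) + 1)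
          * α.quantum ∧
    (seqSum α (lrZeroData (2 ^ (α.manBits - 1)) α.quantum) (2 * 2 ^ (α.manBits - 1) + 1)).toRat
        = (8 * ((2 ^ (α.manBits - 1) : ℕ) : ℚ) ^ 2 + 8 * ((2 ^ (α.manBits - 1) : ℕ) : ℚ))
          * α.quantum := by
  set H : ℕ := 2 ^ (α.manBits - 1) with hH
  set x := lrZeroData H α.quantum with hx
  have hq := α.quantum_pos
  have hH1 : 1 ≤ H := Nat.one_le_two_pow
  obtain ⟨hS, hΛ⟩ := sum_lrZeroData_prefix H hq.le
  obtain ⟨-, -, htail⟩ := seqSum_lrZero hm hR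
  have hxt : ∀ k, H + 2 < k → x k = -(2 * (H : ℚ) * α.quantum) := fun k hk => lrZeroData_tail _ hk
  have h1 := sum_range_stationary x (H + 2) _ _ hxt hS (2 * H + 1) (by omega)
  have h2 := sum_range_stationary (fun i => |x i|) (H + 2) |-(2 * (H : ℚ) * α.quantum)| _
    (fun k hk => by simp only [hxt k hk]) hΛ (2 * H + 1) (by omega)
  have hcast : (((2 * H + 1 : ℕ) : ℚ) - ((H + 2 : ℕ) : ℚ)) = (H : ℚ) - 1 := by push_cast; ring
  refine ⟨?_, ?_, htail _ (by omega)⟩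
  · rw [h1, hcast]; ring
  · rw [h2, hcast, abs_neg, abs_of_nonneg (by positivity)]; ring

end Trajectory

end MiniFloat

end Literature.ComputerArithmetic.FloatingPoint
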